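import Mathlib
import HarnessLib

/-!
# `AffineBernoulli.AlignedStratumTrivial` — test functions II: a radially non-increasing `C¹`
  test function with prescribed slope region
  (route `AffineBernoulli`, item stmt-NavierStokesRegularity-13663, helper file IV)

* `AlignedStratum.exists_profile` — for `0 < R₀ < r₀`: a `C¹` profile `G₀ : ℝ → [0,1]` with
  `G₀' = −β/Z`, `β ≥ 0` a smooth bump supported in `{t > R₀²}`, `β = 1` on `[r₀² − h, r₀² + h]`,
  `Z = ∫ β > 0`, and `G₀ = 0` on `[T₁, ∞)`, `T₁ > r₀²` (normalised primitive of a bump).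
* `AlignedStratum.exists_radialTest` — the radial test function `g(y) = G₀(‖y − c‖²)`:
  `C¹`, values in `[0,1]`, compact support in `closedBall c R₁` (`R₁ > r₀`), and
  `Dg(y)[v] = −(2/Z) β(‖y − c‖²) ⟪y − c, v⟫`; so along any field `V` with `⟪y − c, V y⟫ ≥ 0`
  outside `closedBall c R₀` one has `Dg[V] ≤ 0`, with a quantitative negative slope near the
  sphere of radius `r₀`.

HONEST FRAMING: calculus lemmas serving a Liouville lemma about HYPOTHETICAL self-similar Euler
profiles; nothing here bears on the regularity problem itself.
-/

noncomputable section

set_option linter.dupNamespace false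

namespace Summit.NavierStokesRegularity.NavierStokesRegularity.Theorems

open Set Function Filter Topology InnerProductSpace MeasureTheory Metric
open scoped RealInnerProductSpace

namespace AlignedStratum

/-- **One-dimensional profile.** For `0 < R₀ < r₀` there are a `C¹` function `G₀ : ℝ → [0,1]`, a
smooth bump `β ≥ 0` supported in `{t > R₀²}` with `β = 1` on `[r₀² − h, r₀² + h]`, and `Z > 0`,
`T₁ > r₀²`, such that `G₀' = −β/Z`, and `G₀ = 0` on `[T₁, ∞)` (a normalised primitive of `β`). -/
theorem exists_profile {R₀ r₀ : ℝ} (hR₀ : 0 < R₀) (hr : R₀ < r₀) :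
    ∃ (G₀ β : ℝ → ℝ) (Z h T₁ : ℝ), 0 < Z ∧ 0 < h ∧ r₀ ^ 2 < T₁ ∧
      (∀ u, HasDerivAt G₀ (-β u / Z) u) ∧ ContDiff ℝ 1 G₀ ∧ (∀ u, 0 ≤ G₀ u ∧ G₀ u ≤ 1) ∧
      (∀ u, T₁ ≤ u → G₀ u = 0) ∧ Continuous β ∧
      (∀ t, 0 ≤ β t) ∧ (∀ t, t ≤ R₀ ^ 2 → β t = 0) ∧ (∀ t, |t - r₀ ^ 2| ≤ h → β t = 1) := by
  have hsq : R₀ ^ 2 < r₀ ^ 2 := by nlinarith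
  set t₀ : ℝ := r₀ ^ 2 with ht₀
  set h : ℝ := (r₀ ^ 2 - R₀ ^ 2) / 4 with hh
  have hh0 : 0 < h := by rw [hh]; linarith
  let b : ContDiffBump t₀ := ⟨h, 2 * h, hh0, by linarith⟩
  set β : ℝ → ℝ := fun t => b t with hβ
  have hβc : Continuous β := b.continuous
  have hβ0 : ∀ t, 0 ≤ β t := fun t => b.nonneg
  have hβ1 : ∀ t, β t ≤ 1 := fun t => b.le_one
  have hβzero : ∀ t, 2 * h ≤ |t - t₀| → β t = 0 := fun t ht =>
    b.zero_of_le_dist (by rw [Real.dist_eq]; exact ht)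
  set Z : ℝ := ∫ t, β t with hZ
  have hZ0 : 0 < Z := b.integral_pos (μ := volume)
  set T₁ : ℝ := t₀ + 2 * h with hT₁
  have hβint : Integrable β volume := b.integrable
  set G₀ : ℝ → ℝ := fun u => (∫ t in u..T₁, β t) / Z with hG₀
  have hD : ∀ u, HasDerivAt G₀ (-β u / Z) u := fun u => by
    have h1 : HasDerivAt (fun u => ∫ t in u..T₁, β t) (-β u) u :=
      intervalIntegral.integral_hasDerivAt_left (hβc.intervalIntegrable _ _)
        (hβc.stronglyMeasurableAtFilter _ _) hβc.continuousAt
    exact h1.div_const Z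
  have hG1 : ContDiff ℝ 1 G₀ := by
    rw [contDiff_one_iff_deriv]
    refine ⟨fun u => (hD u).differentiableAt, ?_⟩
    have : deriv G₀ = fun u => -β u / Z := funext fun u => (hD u).deriv
    rw [this]
    exact (hβc.neg.div_const Z)
  -- `G₀ = 0` beyond `T₁`, values in `[0,1]`
  have hzero : ∀ u, T₁ ≤ u → G₀ u = 0 := by
    intro u hu
    have : ∫ t in u..T₁, β t = 0 := by
      rw [intervalIntegral.integral_symm, neg_eq_zero]
      refine intervalIntegral.integral_zero_ae (Eventually.of_forall fun t ht => ?_)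
      rw [uIoc_of_le hu] at ht
      refine hβzero t ?_
      rw [abs_of_nonneg (by linarith [ht.1])]
      linarith [ht.1]
    simp [hG₀, this]
  have hrange : ∀ u, 0 ≤ G₀ u ∧ G₀ u ≤ 1 := by
    intro u
    rcases le_or_gt T₁ u with hu | hu
    · rw [hzero u hu]; exact ⟨le_rfl, zero_le_one⟩
    · have hle : u ≤ T₁ := hu.le
      have hI : ∫ t in u..T₁, β t = ∫ t in Ioc u T₁, β t := intervalIntegral.integral_of_le hle
      have hnn : 0 ≤ ∫ t in Ioc u T₁, β t := setIntegral_nonneg measurableSet_Ioc fun t _ => hβ0 t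
      have hleZ : ∫ t in Ioc u T₁, β t ≤ Z :=
        setIntegral_le_integral hβint (Eventually.of_forall hβ0)
      refine ⟨?_, ?_⟩
      · rw [hG₀]; dsimp only; rw [hI]; positivity
      · rw [hG₀]; dsimp only; rw [hI, div_le_one hZ0]; exact hleZ
  refine ⟨G₀, β, Z, h, T₁, hZ0, hh0, by rw [hT₁]; linarith, hD, hG1, hrange, hzero, hβc, hβ0,
    fun t ht => hβzero t ?_, fun t ht => ?_⟩
  · rw [abs_of_nonpos (by rw [ht₀]; linarith)]
    rw [ht₀, hh]; linarith
  · exact b.one_of_mem_closedBall (by rw [mem_closedBall, Real.dist_eq]; exact ht)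

/-- **Radial test function.** For `0 < R₀ < r₀` and a centre `c` there is a `C¹` compactly
supported `g : ℝ³ → [0,1]` vanishing off `closedBall c R₁` (`R₁ > r₀`) whose derivative is
`Dg(y)[v] = −(2/Z) β(‖y − c‖²) ⟪y − c, v⟫` with `Z > 0`, `β ≥ 0` continuous, `β = 0` on
`{t ≤ R₀²}` and `β = 1` on `[r₀² − h, r₀² + h]`, `h > 0`. In particular `g` is radially
non-increasing outside `closedBall c R₀`, strictly so near the sphere of radius `r₀`. -/
theorem exists_radialTest (c : EuclideanSpace ℝ (Fin 3)) {R₀ r₀ : ℝ} (hR₀ : 0 < R₀) (hr : R₀ < r₀) :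
    ∃ (g : EuclideanSpace ℝ (Fin 3) → ℝ) (β : ℝ → ℝ) (Z h R₁ : ℝ),
      ContDiff ℝ 1 g ∧ (∀ y, 0 ≤ g y ∧ g y ≤ 1) ∧ 0 < Z ∧ 0 < h ∧ r₀ < R₁ ∧
      (∀ y, R₁ < dist y c → g y = 0) ∧ HasCompactSupport g ∧ Continuous β ∧
      (∀ t, 0 ≤ β t) ∧ (∀ t, t ≤ R₀ ^ 2 → β t = 0) ∧ (∀ t, |t - r₀ ^ 2| ≤ h → β t = 1) ∧
      (∀ y v, fderiv ℝ g y v = -(2 / Z) * β (‖y - c‖ ^ 2) * ⟪y - c, v⟫) := by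
  obtain ⟨G₀, β, Z, h, T₁, hZ, hh, hT₁, hD, hG1, hrange, hzero, hβc, hβ0, hβR, hβ1⟩ :=
    exists_profile hR₀ hr
  have hr₀ : 0 < r₀ := hR₀.trans hr
  have hT₁0 : 0 < T₁ := lt_trans (by positivity) hT₁
  set R₁ : ℝ := √T₁ with hR₁
  set g : EuclideanSpace ℝ (Fin 3) → ℝ := fun y => G₀ (‖y - c‖ ^ 2) with hg
  have hsqD : ∀ y : EuclideanSpace ℝ (Fin 3), HasFDerivAt (fun y => ‖y - c‖ ^ 2)
      (2 • (innerSL ℝ (y - c)).comp (ContinuousLinearMap.id ℝ (EuclideanSpace ℝ (Fin 3)))) y :=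
    fun y => ((hasFDerivAt_id y).sub_const c).norm_sq
  have hgD : ∀ y, HasFDerivAt g ((-β (‖y - c‖ ^ 2) / Z) •
      (2 • (innerSL ℝ (y - c)).comp (ContinuousLinearMap.id ℝ (EuclideanSpace ℝ (Fin 3))))) y :=
    fun y => (hD (‖y - c‖ ^ 2)).comp_hasFDerivAt y (hsqD y)
  refine ⟨g, β, Z, h, R₁, ?_, fun y => hrange _, hZ, hh, ?_, ?_, ?_, hβc, hβ0, hβR, hβ1, ?_⟩
  · exact hG1.comp ((contDiff_id.sub contDiff_const).norm_sq ℝ)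
  · rw [hR₁, Real.lt_sqrt hr₀.le]; exact hT₁
  · intro y hy
    refine hzero _ ?_
    have h1 : R₁ ^ 2 = T₁ := Real.sq_sqrt hT₁0.le
    have h2 : R₁ < ‖y - c‖ := by rwa [← dist_eq_norm]
    have h3 : 0 ≤ R₁ := Real.sqrt_nonneg _
    nlinarith
  · refine HasCompactSupport.intro (isCompact_closedBall c R₁) fun y hy => hzero _ ?_
    rw [mem_closedBall, not_le] at hy
    have h1 : R₁ ^ 2 = T₁ := Real.sq_sqrt hT₁0.le
    have h2 : R₁ < ‖y - c‖ := by rwa [← dist_eq_norm]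
    have h3 : 0 ≤ R₁ := Real.sqrt_nonneg _
    nlinarith
  · intro y v
    rw [(hgD y).fderiv]
    simp only [_root_.smul_apply, ContinuousLinearMap.coe_comp, Function.comp_apply,
      ContinuousLinearMap.coe_id', id_eq, innerSL_apply_apply, smul_eq_mul]
    ring

end AlignedStratum

end Summit.NavierStokesRegularity.NavierStokesRegularity.Theorems
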